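import Literature.Geometry.Riemannian.KernelNashEntropyDirectional
import Literature.Geometry.Riemannian.DistSqDirectionalDatum
import Literature.Geometry.Riemannian.ExpMapDifferential
import Mathlib.Analysis.Calculus.Deriv.Shift
import HarnessLib

/-!
# Bamler's Lipschitz bound for the pointed Nash entropy in its base point
# (Bamler 2020a, Thm. 5.9, gradient part)

R. Bamler, *Entropy and heat kernel bounds on a Ricci flow background*, arXiv:2008.07093 (2020a),
§5.1, Thm. 5.9 (arXiv v1: Thm. 19): if `R(·, s) ≥ R_min` then on `M × (s, ∞)`

  `|∇ 𝒩*_s| ≤ ( n/(2(t − s)) − R_min )^{1/2}`.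

This file PROVES the bound in its integrated (Lipschitz) form for the Riemannian distance `d_{g_t}`:
for a Ricci flow on `[a, T]` of a `C^∞` family of Riemannian metrics on a closed connected manifold
modelled on `ℝᵐ` itself (`m ≥ 3`), `a < s < t < T` and all `x, x'`,

  `|𝒩*_s(x, t) − 𝒩*_s(x', t)| ≤ ( m/(2(t − s)) − R_min )^{1/2} d_t(x, x')`

(`IsRicciFlow.ofReal_abs_kernelNashEntropy_sub_le`), by integrating the directional bound
`IsRicciFlow.abs_deriv_kernelNashEntropy_curve_le` (`KernelNashEntropyDirectional.lean`) along a
minimising unit-speed `g_t`-geodesic from `x` to `x'` (Hopf–Rinow on the compact slice,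
`exists_unit_minimizing`). This is the form in which Thm. 5.9 enters Cor. 5.10 (comparison of
`𝒩*` at different base points through `d_{W₁}`). The Laplacian bounds `−n/(2(t−s)) ≤ □𝒩* ≤ 0`
of Thm. 5.9 are NOT here.

## References

* R. H. Bamler, *Entropy and heat kernel bounds on a Ricci flow background*, arXiv:2008.07093
  (2020), §5.1 Thm. 5.9 (arXiv v1 Thm. 19), §5.3. [Bamler2020Entropy]
-/

noncomputable section

open Set Filter Function MeasureTheory Measure
open scoped Manifold ContDiff Topology ENNReal NNReal

namespace Literature.Geometry.Riemannian

open Lorentzian Lorentzian.PseudoRiemannianMetric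

section Lipschitz

variable {m : ℕ} {M : Type*} [TopologicalSpace M] [ChartedSpace (EuclideanSpace ℝ (Fin m)) M]
  [IsManifold 𝓘(ℝ, EuclideanSpace ℝ (Fin m)) ∞ M] [T2Space M] [CompactSpace M]
  [SecondCountableTopology M] [MeasurableSpace M] [BorelSpace M] [ConnectedSpace M]
  {h : ℝ → PseudoRiemannianMetric 𝓘(ℝ, EuclideanSpace ℝ (Fin m)) ∞ (EuclideanSpace ℝ (Fin m))
    (TangentSpace 𝓘(ℝ, EuclideanSpace ℝ (Fin m)) : M → Type _)}
  {cov : ℝ → CovariantDerivative 𝓘(ℝ, EuclideanSpace ℝ (Fin m)) (EuclideanSpace ℝ (Fin m))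
    (TangentSpace 𝓘(ℝ, EuclideanSpace ℝ (Fin m)) : M → Type _)}
  {a T : ℝ} (hflow : IsRicciFlow h cov (Icc a T)) (hh : IsContMDiffFamilyOn ∞ h univ)
  (hR : ∀ r, (h r).IsRiemannian)

/-- **Bamler 2020a, Thm. 5.9 (gradient bound), Lipschitz form.** Let `hflow = (h, cov)` be a Ricci
flow on `[a, T]` of a `C^∞` family of Riemannian metrics on a closed connected manifold `M`
modelled on `ℝᵐ` (`m ≥ 3`), `a < s < t < T`, `R_{g_s} ≥ R_min`, and write
`𝒩*_s(x, t) = 𝒩_{x,t}(t − s)` for the pointed Nash entropy of the conjugate heat kernel based at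
`(x, t)` evaluated at time `s` (`pointedNashEntropy` of `KernelNashEntropy.lean`). Then for all
`x, x' ∈ M`,

  `|𝒩*_s(x, t) − 𝒩*_s(x', t)| ≤ ( m/(2(t − s)) − R_min )^{1/2} · d_{g_t}(x, x')`

(stated with `ENNReal.ofReal` against the extended distance `(h t).edist`). Proof: join `x ≠ x'` by
a minimising unit-speed `g_t`-geodesic `γ` of length `d_t(x,x')` (`exists_unit_minimizing`), bound
`|d/dσ 𝒩*_s(γ σ, t)|` at every `σ` by the directional estimate applied to the translated geodesic,
and integrate (mean value inequality).
[cite: Bamler2020Entropy, §5.1, Thm. 5.9 (arXiv v1 Thm. 19), gradient bound] -/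
theorem IsRicciFlow.ofReal_abs_kernelNashEntropy_sub_le (hm : 3 ≤ m) {s t : ℝ} (has : a < s)
    (hst : s < t) (htT : t < T) {Rmin : ℝ}
    (hRmin : ∀ y, Rmin ≤ (h s).scalarCurvatureWith (cov s) y) (x x' : M) :
    ENNReal.ofReal |pointedNashEntropy h (fun r y ↦ hflow.heatKernelFn hh hR t x (y, r)) m t s -
        pointedNashEntropy h (fun r y ↦ hflow.heatKernelFn hh hR t x' (y, r)) m t s| ≤
      ENNReal.ofReal (Real.sqrt ((m : ℝ) / (2 * (t - s)) - Rmin)) * (h t).edist (hR t) x x' := by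
  classical
  set L : ℝ := Real.sqrt ((m : ℝ) / (2 * (t - s)) - Rmin) with hL
  have hL0 : 0 ≤ L := Real.sqrt_nonneg _
  set N : M → ℝ :=
    fun z ↦ pointedNashEntropy h (fun r y ↦ hflow.heatKernelFn hh hR t z (y, r)) m t s with hN
  by_cases hxx' : x = x'
  · subst hxx'
    simp
  -- geodesic set-up on the slice `g = h t`
  set g := h t with hg_def
  haveI : Fact ((1 : ℕ∞ω) ≤ (∞ : ℕ∞ω)) := ⟨by exact_mod_cast le_top⟩
  have h2 : (2 : ℕ∞ω) ≤ (∞ : ℕ∞ω) := WithTop.coe_le_coe.mpr le_top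
  haveI := g.hasLeviCivita
  haveI : CovariantDerivative.ContMDiffCovariantDerivative g.leviCivita 1 :=
    contMDiffCovariantDerivative_leviCivita_of_two_le g h2
  haveI : CovariantDerivative.ContMDiffCovariantDerivative g.leviCivita ((⊤ : ℕ∞) : ℕ∞ω) :=
    contMDiffCovariantDerivative_leviCivita_infty g le_rfl
  have hc : IsGeodesicallyComplete g.leviCivita :=
    isGeodesicallyComplete_of_compactSpace g h2 (hR t)
  obtain ⟨u, T₀, hT₀, hu1, hexp, hdist⟩ := exists_unit_minimizing g (hR t) hc hxx'
  set γ : ℝ → M := maximalGeodesic g.leviCivita x u with hγ_def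
  have hcurve : ∀ (p : M) (v : TangentSpace 𝓘(ℝ, EuclideanSpace ℝ (Fin m)) p),
      ContMDiff 𝓘(ℝ, ℝ) 𝓘(ℝ, EuclideanSpace ℝ (Fin m)) ∞ (maximalGeodesic g.leviCivita p v) :=
    fun p v ↦ (contMDiff_maximalGeodesic_family hc p).comp
      (contMDiff_id.prodMk (contMDiff_const (c := (show EuclideanSpace ℝ (Fin m) from v))))
  have hγs : ContMDiff 𝓘(ℝ, ℝ) 𝓘(ℝ, EuclideanSpace ℝ (Fin m)) ∞ γ := hcurve x u
  obtain ⟨-, -, hγ0, hγv⟩ := maximalGeodesic_of_isGeodesicallyComplete hc x u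
  have hγT : γ T₀ = x' := by rw [hγ_def, ← expMap_smul hc x u T₀]; exact hexp
  -- derivative bound at every parameter: translate the geodesic
  have hbound : ∀ σ₀ : ℝ, |deriv (fun σ ↦ N (γ σ)) σ₀| ≤ L := by
    intro σ₀
    set γ' : ℝ → M := maximalGeodesic g.leviCivita (γ σ₀)
      (velocity 𝓘(ℝ, EuclideanSpace ℝ (Fin m)) γ σ₀) with hγ'_def
    have hγ'eq : ∀ τ, γ' τ = γ (τ + σ₀) := fun τ ↦ maximalGeodesic_velocity_apply hc x u σ₀ τ
    have hγ's : ContMDiff 𝓘(ℝ, ℝ) 𝓘(ℝ, EuclideanSpace ℝ (Fin m)) ∞ γ' := hcurve _ _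
    have hspeed : g.val (γ' 0) (velocity 𝓘(ℝ, EuclideanSpace ℝ (Fin m)) γ' 0)
        (velocity 𝓘(ℝ, EuclideanSpace ℝ (Fin m)) γ' 0) ≤ 1 := by
      have e1 : g.val (γ' 0) (velocity 𝓘(ℝ, EuclideanSpace ℝ (Fin m)) γ' 0)
          (velocity 𝓘(ℝ, EuclideanSpace ℝ (Fin m)) γ' 0) =
          g.val (γ σ₀) (velocity 𝓘(ℝ, EuclideanSpace ℝ (Fin m)) γ σ₀)
            (velocity 𝓘(ℝ, EuclideanSpace ℝ (Fin m)) γ σ₀) := by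
        rw [hγ'_def]
        exact val_velocity_maximalGeodesic hc _ _ 0
      rw [e1, hγ_def, val_velocity_maximalGeodesic hc x u σ₀, hu1]
    have hb := hflow.abs_deriv_kernelNashEntropy_curve_le hh hR hm has hst htT hγ's hspeed hRmin
    -- `deriv (N ∘ γ) σ₀ = deriv (N ∘ γ') 0`
    have hshift : deriv (fun σ ↦ N (γ σ)) σ₀ = deriv (fun τ ↦ N (γ' τ)) 0 := by
      have h1 : (fun τ ↦ N (γ' τ)) = fun τ ↦ N (γ (τ + σ₀)) := funext fun τ ↦ by rw [hγ'eq τ]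
      have e := deriv_comp_add_const (f := fun σ ↦ N (γ σ)) (a := σ₀) (x := 0)
      rw [zero_add] at e
      rw [h1, e]
    rw [hshift]
    exact hb
  -- differentiability of `N ∘ γ` everywhere (same translation)
  have hdiff : ∀ σ₀ : ℝ, DifferentiableAt ℝ (fun σ ↦ N (γ σ)) σ₀ := by
    intro σ₀
    set γ' : ℝ → M := maximalGeodesic g.leviCivita (γ σ₀)
      (velocity 𝓘(ℝ, EuclideanSpace ℝ (Fin m)) γ σ₀) with hγ'_def
    have hγ'eq : ∀ τ, γ' τ = γ (τ + σ₀) := fun τ ↦ maximalGeodesic_velocity_apply hc x u σ₀ τ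
    have hγ's : ContMDiff 𝓘(ℝ, ℝ) 𝓘(ℝ, EuclideanSpace ℝ (Fin m)) ∞ γ' := hcurve _ _
    have hD := hflow.hasDerivAt_kernelNashEntropy_curve hh hR has hst htT hγ's
    have h1 : (fun τ ↦ N (γ' τ)) = fun τ ↦ N (γ (τ + σ₀)) := funext fun τ ↦ by rw [hγ'eq τ]
    have hD1 : HasDerivAt (fun τ ↦ N (γ (τ + σ₀))) _ 0 := h1 ▸ hD
    have hD2 := HasDerivAt.comp_sub_const (f := fun τ ↦ N (γ (τ + σ₀))) σ₀ σ₀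
      (by rw [sub_self]; exact hD1)
    have h2 : (fun x ↦ (fun τ ↦ N (γ (τ + σ₀))) (x - σ₀)) = fun σ ↦ N (γ σ) := by
      funext σ; simp only [sub_add_cancel]
    rw [h2] at hD2
    exact hD2.differentiableAt
  -- mean value inequality on `[0, T₀]`
  have hMVT : |N (γ T₀) - N (γ 0)| ≤ L * T₀ := by
    have := Convex.norm_image_sub_le_of_norm_deriv_le (f := fun σ ↦ N (γ σ)) (s := univ)
      (fun σ _ ↦ hdiff σ) (fun σ _ ↦ by rw [Real.norm_eq_abs]; exact hbound σ) convex_univ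
      (mem_univ 0) (mem_univ T₀)
    rw [Real.norm_eq_abs, Real.norm_eq_abs, sub_zero, abs_of_pos hT₀] at this
    exact this
  have hγ0' : γ 0 = x := hγ0
  rw [hγT, hγ0', abs_sub_comm] at hMVT
  -- conclude
  change ((h t).edist (hR t) x x').toReal = T₀ at hdist
  have hne : (h t).edist (hR t) x x' ≠ ⊤ := fun htop ↦ by
    rw [htop, ENNReal.toReal_top] at hdist
    exact hT₀.ne' hdist.symm
  have hT₀d : (h t).edist (hR t) x x' = ENNReal.ofReal T₀ := by
    rw [← hdist, ENNReal.ofReal_toReal hne]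
  rw [hT₀d, ← ENNReal.ofReal_mul hL0]
  exact ENNReal.ofReal_le_ofReal hMVT

end Lipschitz

end Literature.Geometry.Riemannian

end
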